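/-
Copyright (c) 2026 the pub-hodgecm-mathlib formalisation cell (harness21).  Prover seat hodgecm-mathlib-R90-C131-p02 (g0) (R90-TF S4 hand lent to L1
by CHAIR VALVE WORD W4), Track B «K2-LIT», hLiu418 = `stmt-HodgeConjecture-24832`; LEAD F0P6-plan (g14) BATCH #87 (2) (K1a-3-arch), K1-a♮ line lead
K2E5-p16 (g8) WORD #3 (4) «(a) = GO §4 `archSingularBlock_continuation_of_steps` tonight».  THEOREMS ONLY (no `def`, no instance, no notation, no
named-fact hypothesis, no `sorry`); one-variable holomorphy bookkeeping, all analytic letters BY VALUE.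
-/
import Summits.HodgeConjecture.HodgeConjecture.Theorems.K2LiuLadderIntertwinerScalars   -- ★ (H1) `differentiableOn_finset_prod`
import Mathlib.Analysis.SpecialFunctions.Gamma.Deriv                                    -- `Complex.differentiableAt_Gamma`
import Mathlib.Analysis.SpecialFunctions.Gamma.Beta                                     -- `Complex.differentiable_one_div_Gamma`
import HarnessLib

/-!
# Crux `HLiu418`, KIND 1 a♮ (K1a-3-arch) — the ARCHIMEDEAN SINGULAR (rank-one) big-cell block is HOLOMORPHIC ON `{0 < re s}` once its three local
# steps are: the assembly `blk(s) = c · a₂(s) · a₁(s) · W(s − ½)` in ★ FILE 10's `archBlock_prod_continuation` ∃-shape, the `s₁ = s − ½` shift, the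
# finite product over real places, and the Γ-ratio letters `π/s`, `Γ(2s+a)/Γ(2s+b)`

Cell `hodgecm-mathlib`, crux item hLiu418 = `stmt-HodgeConjecture-24832` (helper lane `--supports … --as helper`, count-neutral).  Census memo of this
hand `R90/R90-C131-p02/g0/L1-K1a3arch/CENSUS-K1a3-arch.R90-C131-p02-g0.md` (6d4fbf3ebe90d768); line memo `K2/K2E5-p16/g8/CENSUS-K1a-GK.K2E5-p16-g8.md`
(7c6ffe7718f089b5) §1∕§3.

THE MATHEMATICS (memo §1 at a real place `w`; [Casselman1980, §3 Thm. 3.1]; [KudlaRallis1994, §2]; [Shimura1997, §16.4]).  The twisted rank-one big-cell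
block at `w` — `blk(s) = ∫_{Herm₂(ℂ)} \overline{𝐞(σ·b₁₁)} F_s(x_w·n(b)·g_w) db` for a flat `K_∞`-finite family `F_s ∈ I_w(s, χ_k)` — unfolds along the
reduced word `w_Δ = s₂s₁s₂` (Fubini with `b₁₁` outermost) into THREE local steps: the corner Siegel intertwining `A₂^∞` (scalar `a₂(s)`, a Γ-ratio of
`L_ℝ(2s+1,ε_∞)/L_ℝ(2s+2,ε_∞)` type, poles on `re s ≤ −½`), the Levi `GL₂(ℂ)` intertwining `A₁^∞` (scalar `a₁(s)` of `Γ_ℂ(2s)/Γ_ℂ(2s+1) = π/s` type, pole at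
`s = 0` only), and the twisted last letter = the rank-one archimedean Whittaker function `W` of the corner section at the SHIFTED parameter `s₁ = s − ½`
(★ W1-arch `K2LiuRankOneArchWhittakerEvenHolomorphy.differentiableOn_oddClosedForm`: holomorphic on `{−½ < re s₁}` = `{0 < re s}`).  Hence, GIVEN the three
steps by value on `{½ < re s}`, `blk` continues to a function HOLOMORPHIC ON `{0 < re s}` — the arch interface (K1a-4) consumes (`HEAD_T^{cont}`, letter `hEad`).
This file is that ASSEMBLY and its bookkeeping; the three analytic inputs (N1) arch iterated cocycle, (N2) single-step arch scalars, (N3) corner restriction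
are NOT proved here (booked as bricks, line lead WORD #3 (4)).
* §1 `differentiableOn_comp_sub_half` — `W` holomorphic on `{−½ < re}` ⇒ `s ↦ W(s − ½)` holomorphic on `{0 < re}` (the `s₁ = s − ½` reading).
* §2 **`archSingularBlock_continuation_of_steps`** — ONE place: `∃ E, DifferentiableOn ℂ E {0<re} ∧ ∀ s, ½ < re s → blk s = E s`; the same with a parameter
  (`blk : ℂ → X → ℂ`, `W : ℂ → X → ℂ`: the point `g_w`/height argument) `archSingularBlock_continuation_of_steps_param`.
* §3 **`archSingularBlock_prod_continuation_of_steps`** — finitely many real places (`Fintype σ`): `∏_w blk_w(s) = E(s)` (★ (H1) `differentiableOn_finset_prod`).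
* §4 the Γ-ratio letters: `differentiableOn_const_div` (`c / s`), `differentiableOn_Gamma_two_mul_add` (`Γ(2s + a)`, `0 ≤ re a`),
  `differentiableOn_Gamma_ratio` (`Γ(2s+a)·Γ(2s+b)⁻¹`, `0 ≤ re a`, any `b` — `1/Γ` is entire), all on `{0 < re s}`.

HONEST LABEL: assembly + letters only; it moves NO analysis ((N1)–(N3) open); closes no socket.  HC_CM is proved only modulo the 7 printed citations
(2 remaining named inputs: hLiu418 = `stmt-HodgeConjecture-24832`, h413 = `stmt-HodgeConjecture-24833`) until rung 0 closes.  REL ≠ ★ ≠ BUILT.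

## References
* [Casselman1980] W. Casselman, *The unramified principal series of p-adic groups I*, Compositio Math. 40 (1980), §3 Thm. 3.1 (cocycle along `s₂s₁s₂`).
* [KudlaRallis1994] S. Kudla, S. Rallis, *A regularized Siegel–Weil formula: the first term identity*, Ann. of Math. 140 (1994), §1–§2.
* [Shimura1997] G. Shimura, *Euler Products and Eisenstein Series*, CBMS 93 (1997), §16.4, §18.4–18.5.
* [Bump1997] D. Bump, *Automorphic Forms and Representations* (1997), §1.6 (archimedean Whittaker functions).
-/

set_option autoImplicit false
set_option linter.dupNamespace false

noncomputable section

open Complex Set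

namespace Summit.HodgeConjecture.HodgeConjecture.Cruxes.HLiu418.K2LiuRankOneSingularArchRegularity

open Summit.HodgeConjecture.HodgeConjecture.Cruxes.HLiu418.K2LiuLadderIntertwinerScalars (differentiableOn_finset_prod)

/-! ## §1 The shift `s₁ = s − ½` -/

/-- `s ↦ s − ½` maps `{0 < re s}` into `{−½ < re}`. [Bump1997, §1.6] -/
theorem mapsTo_sub_half : MapsTo (fun s : ℂ => s - 1 / 2) {s : ℂ | 0 < s.re} {s : ℂ | -(1 / 2) < s.re} := by
  intro s hs
  simp only [mem_setOf_eq, sub_re] at hs ⊢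
  have h : ((1 : ℂ) / 2).re = 1 / 2 := by norm_num
  rw [h]
  linarith

/-- **The `s₁ = s − ½` reading**: a rank-one letter `W` holomorphic on `{−½ < re s₁}` (★ W1-arch) gives `s ↦ W(s − ½)` holomorphic on `{0 < re s}`.
[Bump1997, §1.6] -/
theorem differentiableOn_comp_sub_half {W : ℂ → ℂ} (hW : DifferentiableOn ℂ W {s : ℂ | -(1 / 2) < s.re}) :
    DifferentiableOn ℂ (fun s : ℂ => W (s - 1 / 2)) {s : ℂ | 0 < s.re} :=
  hW.comp ((differentiableOn_id).sub (differentiableOn_const _)) mapsTo_sub_half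

/-! ## §2 One real place: continuation of the twisted block from its three steps -/

/-- **(K1a-3-arch) ASSEMBLY, one place.**  If on `{½ < re s}` the twisted rank-one block factors through its three local steps,
`blk(s) = c · a₂(s) · a₁(s) · W(s − ½)`, with `a₂`, `a₁` holomorphic on `{0 < re}` (the two arch intertwining scalars: poles on `re s ≤ 0` only) and `W`
holomorphic on `{−½ < re}` (the rank-one arch Whittaker letter), then `blk` agrees on `{½ < re s}` with a function HOLOMORPHIC ON `{0 < re s}` — ★ FILE 10's
`archBlock_continuation` ∃-shape for the SINGULAR term. [Casselman1980, §3 Thm. 3.1] [KudlaRallis1994, §2] [Shimura1997, §16.4] -/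
theorem archSingularBlock_continuation_of_steps (blk : ℂ → ℂ) (c : ℂ) (a₂ a₁ W : ℂ → ℂ)
    (ha₂ : DifferentiableOn ℂ a₂ {s : ℂ | 0 < s.re}) (ha₁ : DifferentiableOn ℂ a₁ {s : ℂ | 0 < s.re})
    (hW : DifferentiableOn ℂ W {s : ℂ | -(1 / 2) < s.re})
    (hsteps : ∀ s : ℂ, 1 / 2 < s.re → blk s = c * a₂ s * a₁ s * W (s - 1 / 2)) :
    ∃ E : ℂ → ℂ, DifferentiableOn ℂ E {s : ℂ | 0 < s.re} ∧ ∀ s : ℂ, 1 / 2 < s.re → blk s = E s :=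
  ⟨fun s => c * a₂ s * a₁ s * W (s - 1 / 2),
    (((differentiableOn_const c).mul ha₂).mul ha₁).mul (differentiableOn_comp_sub_half hW), hsteps⟩

/-- **(K1a-3-arch) ASSEMBLY with a parameter** (the point `g_w` ∕ the height argument `x : X` of the block and of the Whittaker letter): the same,
uniformly in `x`. [Casselman1980, §3 Thm. 3.1] [Shimura1997, §16.4] -/
theorem archSingularBlock_continuation_of_steps_param {X : Type*} (blk : ℂ → X → ℂ) (c : X → ℂ) (a₂ a₁ : ℂ → ℂ) (W : ℂ → X → ℂ)
    (ha₂ : DifferentiableOn ℂ a₂ {s : ℂ | 0 < s.re}) (ha₁ : DifferentiableOn ℂ a₁ {s : ℂ | 0 < s.re})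
    (hW : ∀ x, DifferentiableOn ℂ (fun s => W s x) {s : ℂ | -(1 / 2) < s.re})
    (hsteps : ∀ s : ℂ, 1 / 2 < s.re → ∀ x, blk s x = c x * a₂ s * a₁ s * W (s - 1 / 2) x) :
    ∃ E : ℂ → X → ℂ, (∀ x, DifferentiableOn ℂ (fun s => E s x) {s : ℂ | 0 < s.re}) ∧ ∀ s : ℂ, 1 / 2 < s.re → ∀ x, blk s x = E s x :=
  ⟨fun s x => c x * a₂ s * a₁ s * W (s - 1 / 2) x,
    fun x => (((differentiableOn_const (c x)).mul ha₂).mul ha₁).mul (differentiableOn_comp_sub_half (hW x)), hsteps⟩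

/-! ## §3 Finitely many real places: the product -/

/-- **(K1a-3-arch) ASSEMBLY over a finite set `σ` of real places**: place by place as in §2, then `∏_w blk_w(s) = E(s)` with `E` holomorphic on
`{0 < re s}` (★ (H1) `differentiableOn_finset_prod`) — the arch factor of (K1a-4)'s `HEAD_T^{cont}`. [KudlaRallis1994, §1–§2] [Shimura1997, §16.4] -/
theorem archSingularBlock_prod_continuation_of_steps {σ : Type*} [Fintype σ] (blk : σ → ℂ → ℂ) (c : σ → ℂ) (a₂ a₁ W : σ → ℂ → ℂ)
    (ha₂ : ∀ w, DifferentiableOn ℂ (a₂ w) {s : ℂ | 0 < s.re}) (ha₁ : ∀ w, DifferentiableOn ℂ (a₁ w) {s : ℂ | 0 < s.re})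
    (hW : ∀ w, DifferentiableOn ℂ (W w) {s : ℂ | -(1 / 2) < s.re})
    (hsteps : ∀ w, ∀ s : ℂ, 1 / 2 < s.re → blk w s = c w * a₂ w s * a₁ w s * W w (s - 1 / 2)) :
    ∃ E : ℂ → ℂ, DifferentiableOn ℂ E {s : ℂ | 0 < s.re} ∧ ∀ s : ℂ, 1 / 2 < s.re → ∏ w, blk w s = E s := by
  choose E hE hEq using fun w => archSingularBlock_continuation_of_steps (blk w) (c w) (a₂ w) (a₁ w) (W w) (ha₂ w) (ha₁ w) (hW w) (hsteps w)
  exact ⟨fun s => ∏ w, E w s, differentiableOn_finset_prod _ _ _ fun w _ => hE w,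
    fun s hs => Finset.prod_congr rfl fun w _ => hEq w s hs⟩

/-! ## §4 The Γ-ratio letters are holomorphic on `{0 < re s}` -/

/-- `s ↦ c / s` is holomorphic on `{0 < re s}` (the `A₁^∞` letter `Γ_ℂ(2s)/Γ_ℂ(2s+1) = π/s` has its only pole at `s = 0`). [Bump1997, §1.6] -/
theorem differentiableOn_const_div (c : ℂ) : DifferentiableOn ℂ (fun s : ℂ => c / s) {s : ℂ | 0 < s.re} :=
  (differentiableOn_const c).div differentiableOn_id fun s hs h0 => by
    simp only [mem_setOf_eq, h0, zero_re, lt_self_iff_false] at hs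

/-- on `{0 < re s}`, `2s + a` is never a pole of `Γ` when `0 ≤ re a`. [folklore] -/
theorem two_mul_add_ne_neg_nat {s a : ℂ} (hs : 0 < s.re) (ha : 0 ≤ a.re) (m : ℕ) : 2 * s + a ≠ -(m : ℂ) := by
  intro h
  have h1 := congrArg Complex.re h
  simp only [add_re, mul_re, neg_re, natCast_re] at h1
  have h2 : (2 : ℂ).re = 2 := rfl
  have h3 : (2 : ℂ).im = 0 := rfl
  rw [h2, h3, zero_mul, sub_zero] at h1
  have h4 : (0 : ℝ) ≤ m := Nat.cast_nonneg m
  linarith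

/-- **`s ↦ Γ(2s + a)` is holomorphic on `{0 < re s}` for `0 ≤ re a`** (the numerators of the `A₂^∞`, `A₁^∞` Γ-ratios: poles on `re s ≤ −re a / 2 ≤ 0` only).
[Shimura1997, §16.4] -/
theorem differentiableOn_Gamma_two_mul_add {a : ℂ} (ha : 0 ≤ a.re) :
    DifferentiableOn ℂ (fun s : ℂ => Gamma (2 * s + a)) {s : ℂ | 0 < s.re} := by
  intro s hs
  have hlin : DifferentiableAt ℂ (fun s : ℂ => 2 * s + a) s := ((differentiableAt_const _).mul differentiableAt_id).add (differentiableAt_const _)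
  exact ((differentiableAt_Gamma _ (two_mul_add_ne_neg_nat hs ha)).comp s hlin).differentiableWithinAt

/-- **`s ↦ Γ(2s + a) · Γ(2s + b)⁻¹` is holomorphic on `{0 < re s}`** for `0 ≤ re a` and ANY `b` (`1/Γ` is entire, Mathlib `differentiable_one_div_Gamma`)
— the shape of both arch intertwining scalars `a₂`, `a₁` up to exponential∕constant factors. [Shimura1997, §16.4] [KudlaRallis1994, §2] -/
theorem differentiableOn_Gamma_ratio {a : ℂ} (ha : 0 ≤ a.re) (b : ℂ) :
    DifferentiableOn ℂ (fun s : ℂ => Gamma (2 * s + a) * (Gamma (2 * s + b))⁻¹) {s : ℂ | 0 < s.re} := by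
  refine (differentiableOn_Gamma_two_mul_add ha).mul ?_
  have hlin : Differentiable ℂ (fun s : ℂ => 2 * s + b) := ((differentiable_const _).mul differentiable_id).add (differentiable_const _)
  exact (differentiable_one_div_Gamma.comp hlin).differentiableOn

/-- **An arch scalar of the shape `e · q^s · Γ(2s+a) · Γ(2s+b)⁻¹`** (`q ≠ 0` a positive constant such as `π` or `2π` read in `ℂ`, exponential `q^s = exp(s log q)`)
is holomorphic on `{0 < re s}` (`0 ≤ re a`). [Shimura1997, §16.4] -/
theorem differentiableOn_archScalar_shape (e q : ℂ) {a : ℂ} (ha : 0 ≤ a.re) (b : ℂ) :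
    DifferentiableOn ℂ (fun s : ℂ => e * Complex.exp (s * Complex.log q) * (Gamma (2 * s + a) * (Gamma (2 * s + b))⁻¹)) {s : ℂ | 0 < s.re} :=
  ((differentiableOn_const e).mul ((differentiableOn_id.mul (differentiableOn_const _)).cexp)).mul (differentiableOn_Gamma_ratio ha b)

end Summit.HodgeConjecture.HodgeConjecture.Cruxes.HLiu418.K2LiuRankOneSingularArchRegularity

end
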